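import Literature.AlgebraicGeometry.Resolution.ResolutionOfCurves
import Literature.AlgebraicGeometry.Resolution.RegularLocalRingsNormal
import Literature.AlgebraicGeometry.Resolution.RegularLocusOpen
import Literature.AlgebraicGeometry.Resolution.QuasiExcellentSchemes
import Mathlib.AlgebraicGeometry.Morphisms.IsIso
import Mathlib.RingTheory.LocalProperties.IntegrallyClosed

/-!
# `WeightedThesis` — the normalisation is an isomorphism over the regular locus

Support lemma for crux `stmt-ResolutionOfSingularities-0569`, line `kunz-tower-exceptional-defect`,
stub `stub_normalizationIso`: for an integral scheme `X` (locally of finite type over a field, a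
hypothesis of the line that is not needed here) the normalisation `normalizationι X : X^ν ⟶ X`
(`NormalizationOfVarieties.lean`) restricts to an isomorphism over every open `U ⊆ Reg X`.

Proof: being an isomorphism is Zariski-local on the target, so it suffices to treat the non-empty
affine opens `W ⊆ U`; there `Γ(X, W)` is integrally closed — its localisations at primes are the
local rings of `X` at points of `W ⊆ Reg X`, which are regular (`mem_regularLocus_fromSpec_iff`)
hence integrally closed (Matsumura 19.4, `isIntegrallyClosed_of_isRegularLocalRing`), and integral
closedness is a local property — so `isIso_normalizationι_morphismRestrict` applies.
-/

noncomputable section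

open CategoryTheory AlgebraicGeometry TopologicalSpace
open Literature.AlgebraicGeometry.Resolution

set_option linter.dupNamespace false

namespace Summit.ResolutionOfSingularities.ResolutionOfSingularities.Theorems.WeightedThesis.KunzTower

universe u

/-- The coordinate ring of a non-empty affine open `W` of an integral scheme with `W ⊆ Reg X` is
integrally closed: its localisations at maximal ideals are regular local rings of `X`, hence
integrally closed, and being integrally closed is a local property. [folklore] -/
theorem isIntegrallyClosed_of_subset_regularLocus {X : Scheme.{u}} [IsIntegral X] {W : X.Opens}
    (hW : IsAffineOpen W) [Nonempty W] (hreg : (W : Set X) ⊆ Scheme.regularLocus X) :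
    IsIntegrallyClosed Γ(X, W) := by
  refine IsIntegrallyClosed.of_localization_maximal fun 𝔭 _ h𝔭 => ?_
  let q : PrimeSpectrum Γ(X, W) := ⟨𝔭, h𝔭.isPrime⟩
  have hq : hW.fromSpec q ∈ W := hW.range_fromSpec.le ⟨q, rfl⟩
  haveI : IsRegularLocalRing (Localization.AtPrime q.asIdeal) :=
    (mem_regularLocus_fromSpec_iff hW q).mp (hreg hq)
  exact isIntegrallyClosed_of_isRegularLocalRing (Localization.AtPrime q.asIdeal)

/-- The normalisation of an integral scheme is an isomorphism over every open contained in the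
regular locus (Zariski-locally on the target this is `isIso_normalizationι_morphismRestrict` over
the non-empty affine opens, whose coordinate rings are integrally closed by
`isIntegrallyClosed_of_subset_regularLocus`). [folklore] -/
theorem isIso_normalizationι_morphismRestrict_of_subset_regularLocus (X : Scheme.{u})
    [IsIntegral X] (U : X.Opens) (hU : (U : Set X) ⊆ Scheme.regularLocus X) :
    IsIso (normalizationι X ∣_ U) := by
  have key : MorphismProperty.isomorphisms Scheme (normalizationι X ∣_ U) := by
    refine (IsZariskiLocalAtTarget.iff_of_iSup_eq_top
      (P := MorphismProperty.isomorphisms Scheme) _ (iSup_nonempty_affineOpens_eq_top U)).mpr ?_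
    rintro ⟨W, hWne⟩
    show IsIso ((normalizationι X ∣_ U) ∣_ (W : (U : Scheme.{u}).Opens))
    obtain ⟨w⟩ := hWne
    have hW' : IsAffineOpen (U.ι ''ᵁ (W : (U : Scheme.{u}).Opens)) :=
      W.2.image_of_isOpenImmersion U.ι
    have hw : U.ι w.1 ∈ U.ι ''ᵁ (W : (U : Scheme.{u}).Opens) := ⟨w.1, w.2, rfl⟩
    haveI : Nonempty (U.ι ''ᵁ (W : (U : Scheme.{u}).Opens) : X.Opens) := ⟨⟨_, hw⟩⟩
    have hsub : ((U.ι ''ᵁ (W : (U : Scheme.{u}).Opens) : X.Opens) : Set X) ⊆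
        Scheme.regularLocus X :=
      fun x hx => hU (U.ι_image_le _ hx)
    have h : IsIso (normalizationι X ∣_ U.ι ''ᵁ (W : (U : Scheme.{u}).Opens)) :=
      isIso_normalizationι_morphismRestrict X hW' ⟨_, hw⟩
        (isIntegrallyClosed_of_subset_regularLocus hW' hsub)
    exact ((MorphismProperty.isomorphisms Scheme).arrow_mk_iso_iff
      (morphismRestrictRestrict (normalizationι X) U W)).mpr h
  exact key

/-- **Stub `stub_normalizationIso`** (line `kunz-tower-exceptional-defect`): for an integral scheme
locally of finite type over a field, `normalizationι X` restricts to an isomorphism over every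
open `U` contained in the regular locus (regular local rings are integrally closed, so `U` is
normal and the normalisation is an isomorphism over it). [folklore] -/
theorem stub_normalizationIso :
    ∀ (k : Type) [Field k] (X : Scheme.{0}) (f : X ⟶ Spec (.of k)) [IsIntegral X]
      [LocallyOfFiniteType f] (U : X.Opens), (U : Set X) ⊆ Scheme.regularLocus X →
      IsIso (normalizationι X ∣_ U) := by
  intro _ _ X _ _ _ U hU
  exact isIso_normalizationι_morphismRestrict_of_subset_regularLocus X U hU

end Summit.ResolutionOfSingularities.ResolutionOfSingularities.Theorems.WeightedThesis.KunzTower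

end
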